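import Summits.QuantumFields.YangMills.Theorems.UnitScaleTiltHalvingStepOfPillarsRoom
import HarnessLib

/-!
# Route `UnitScaleTilt`, crux K1 child «MinimiserStabilityRegPr» (stmt-QuantumFields-19200), registered stub V2′ `stub_halvingStep` (v8∕v10 `BirthV10`) —
# **THE DOOR WITH THE ROOM BINDER, FILE 2∕2 (★★OWNER RULING №29 (A), LEAD-H L-4 + addendum): THE ROOM-STUB TEXT `RoomHalvingText L` FROM THE THREE DISPLAYED TEXTS**
# — `halvingStep_of_rows_room (hP2) (hP1room) (hCE) : ∀ L, RoomHalvingText L` through FILE 1's minimiser-currency room halving ✓`HalvingStepOfPillarsRoom.roomHalving_of_rows`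

Cell `ym3-torus` (HUMAN RULING D-0037, YM ladder rung R3 — continuum SU(2) YM₃ on the torus is a RUNG, not the Clay problem), width seat `ym-ust-19200-w3` gen 5.
`--supports stmt-QuantumFields-19200 --as helper`; def-free, 0 sorry, standard axioms.  The three texts are HYPOTHESES; nothing here claims the stub, the crux, the rung
or the mass gap.

THE ROOM-STUB TEXT (LEAD-H L-4 addendum (A), adopted ★★OWNER №29 (A); displayed inline, no definition):
`RoomHalvingText L := 1 < L → ∃ B₃ : ℝ, 4 < B₃ ∧ ∃ a₅ : ℝ, 0 < a₅ ∧ ∃ N : ℕ, ∀ (i : Idx L), N ≤ (i.1.1).L ^ ((i.1.1).m + i.1.2.1) → ∀ (ε₀ ε₁ : ℝ), 0 < ε₁ →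
∀ (V : (famX L i).Bdry) (U : (famX L i).Cfg), (famX L i).Reg7 ε₁ V → (famX L i).InU ε₀ U → (famX L i).InB V U → (famX L i).IsCritical V U → ε₀ ≤ a₅ →
(famX L i).InU (max (B₃ * ε₁) (ε₀ / 2)) U` — the registered body of `BirthV10.stub_halvingStep` after `∀ L > 1` with ONE extra premise `N ≤ L^{F.m+n}` on the member
`i = ⟨(F, n, K), _⟩`, `N` ∃-bound after `a₅`.  The members below `N` (finitely many `(F.m+n)`-classes per `L`, every `K`) are NOT claimed: they are «H-SMALL», the pure
implication `stub_of_roomHalving : (∀ L, RoomHalvingText L) → <stub literal>` (route (b7) cover lift in stationarity currency pending ★w3-20520 g5's LOCATE (v)(vi),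
fallback (b3) flat background `U₀ ≠ 1` = WANTED №g26-8; ★★OWNER RULING №29 (B)).

WHAT THIS FILE PROVES (no definition, no sorry):
* §3 `roomStubText_of_roomHalving` — minimiser currency ⟹ the room-stub text, member by member (the carrier's `Reg7`∕`InU`∕`InB`∕`IsCritical` at `famX L ⟨(F,n,K),_⟩` ARE
  `PlaqSmall`∕`RegPr`∕the (0.4)-fibre∕`IsCritR2` definitionally; ✓`Prop8Iter.halvingNative_of_minimisers`' radius argument under the floor `N ≤ L^{F.m+n}`).
* §4 ★★★ **`halvingStep_of_rows_room (hP2) (hP1room) (hCE) : ∀ L, RoomHalvingText L`** — THE DOOR v2.  Binders: `hP2` verbatim ✓`halvingStep_of_rows(')` (inhabited by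
  ✓p625735 `flatOpsAdmAtMS_allL`); `hP1room` = LEAD-H L-4 11:06:10Z (`∃ Nr` next to `B₁`, premise `2 * ρ + Nr ≤ F.L ^ (F.m + n)` right after `hnK`, body = ✓`P1FlatPillar'` unfolded,
  conclusion `P1FlatPillarAt' … (cubeSetM x (K − n) ρ S M 0) …`) behind the SUPPLIER'S FLOORS `∃ (Mₚ Rₚ), ∀ (R M aₑ S) (hM), M = L ^ aₑ → Mₚ ≤ M → Rₚ ≤ R → R * M ≤ S →`
  (hCE's prefix shape; ✓p628195 `p1FlatPillar'_room_of_core'` needs `R'·M ≤ S`, `2L ≤ R'·M + 1`: take `Rₚ := 2L`, `R' := R`); `hCE` = ✓p626483's `hCE′` with the C_E floor letter `∃ (Nce : ℕ)` in front of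
  `(K₁ K₂ C₂ Cce aCE)` and the premise `Nce ≤ F.L ^ (F.m + n)` right after `hnK` (absorbs the suppliers' `a′ + 3 ≤ m + n`, L-4 addendum (A): `Nce := L^{a′+3}`); the door's
  floor is `N := max (2ρ + Nr) Nce` at its (163)-radius `ρ`.
HONEST SCOPE.  Assembly only.  H debt after this file, BY NAME: hP2 ✓; hP1room ⇐ `core′` (J-N05♭, D1) + J5; hCE ⇐ L4 `ceRows_of_chart`; H-SMALL ⇐ `stub_of_roomHalving`
(OPEN, №29 (B)).  NOT a claim about the stub, the crux, the rung or the mass gap.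

References: T. Bałaban, CMP **102** (1985) 277–309 [Balaban1985Variational] (152)–(168) pp.301–304, Prop. 8 p.304, Sect. F p.300; CMP **99** (1985) 75–102
[Balaban1985RegularSpaces] Thm 2 p.83.
-/

set_option autoImplicit false

noncomputable section

open scoped BigOperators Matrix.Norms.L2Operator

namespace Summit.QuantumFields.YangMills.Theorems.HalvingStepOfPillarsRoomDoor

open Literature.MathematicalPhysics.QuantumFieldTheory.Balaban1983to89
open Literature.MathematicalPhysics.QuantumFieldTheory.Balaban1983to89.T3ContinuumYM3Torus
open Literature.MathematicalPhysics.QuantumFieldTheory.Balaban1983to89.T3PrintedRegularMinimiser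
open Literature.MathematicalPhysics.QuantumFieldTheory.Balaban1983to89.T3PrintedMinimiserExistence
open Literature.MathematicalPhysics.QuantumFieldTheory.Balaban1983to89.T3Thm1Carrier
open Literature.MathematicalPhysics.QuantumFieldTheory.Balaban1983to89.T3Thm1CarrierNative (IsCritR2)
open Literature.MathematicalPhysics.QuantumFieldTheory.Balaban1983to89.T3UnitLawDensityEML (ℰp)
open Literature.MathematicalPhysics.QuantumFieldTheory.Balaban1983to89.T3ConstrainedMinimiser (fibre)
open Complex (I)
open B5Eq117TorusCarriers (Mk)
open B5Eq118OneStroke (iterBlockOf)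
open B5Prop12FieldsLattice (distSite distSite_self)
open B6SectADomainsV1 (Domains)
open B6SectAOperatorsV1 (BondIdx SiteIdx)
open B7Prop1Explicit (expUnit)
open B7Eq92Concrete (mgauge)
open B8Ineq132 (BondTouches)
open B8Eq140Level (SideTouches sideTouches_mono Cond140)
open B8Eq143PlaqExpansion (pdiv)
open B8Eq146AExpansion (plaqCovDeriv)
open B8Eq184Proof (cfgExp)
open B8Thm2SetupTorus (cfgPull gaugePull pullDom)
open B10Eq27TorusAxialLog (pull unitsField toUField transl)
open B11Eq115Space (levOf)
open LatticeFieldCalculus (bondAvgIter laplace diverg siteAvgIter)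
open FlatCubeOpsText (Adm22 IsLevWeight FlatOpsAdmAtMS)
open FlatCubeSequenceAligned (cubeSeqMT3)
open FlatCubeSequenceAdm (adm22_cubeSeqMT3)
open FlatOpsLettersAssembly (flatH isFlatH_flatH)
open HalvingQuarterCubeSeq (inOm_top_of_dist)
open HalvingP1FlatPillar (DP1Clause P1FlatPillarAt P1FlatPillar)
open HalvingP1FlatPillarPrime (P1FlatPillarAt' P1FlatPillar' sideTouches_subset_cube0)
open HalvingStepOfPillars (layerChart_of_memberChart)
open HalvingAssemblyInterior (siteClause_of_pieces_int)
open HalvingStepOfPillarsRoom (roomHalving_of_rows)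
open FlatCubeSequenceAligned (cubeSetM)
open HalvingSitePackage (sitePackage_of_rows)
open Summit.QuantumFields.YangMills.Theorems.Prop8ChartDoubleBar (chartLogFlat)

/-! ## §3 The room-stub text from the room halving -/

section Door


/-- **THE ROOM-STUB TEXT FROM THE ROOM HALVING** (member by member; the carrier's `Reg7`∕`InU`∕`InB`∕`IsCritical` at `famX L ⟨(F, n, K), _⟩` ARE `PlaqSmall`∕`RegPr`∕
the (0.4)-fibre∕reading-R2 criticality `IsCritR2`, definitionally — ✓`T3Thm1CarrierNative.halvingStep_famX_iff_native`): a reading-R2-critical `U ∈ 𝔘_k(ε₀) ∩ 𝔅_k(V)`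
minimises over (6) at SOME radius `e > 0`, hence over (6)(`min{e, ε₀}`) (✓`regFibrePr_mono`), the minimiser form applies at `min{e, ε₀} ≤ a₅`, and
`max{B₃ε₁, ½min{e, ε₀}} ≤ max{B₃ε₁, ½ε₀}` with (2) monotone (✓`regPr_mono`) — ✓`Prop8Iter.halvingNative_of_minimisers`' argument under the member floor `N ≤ L^{F.m+n}`.
[cite: Balaban1985Variational, Sect. F p.300 and p.304 before Prop. 8] -/
theorem roomStubText_of_roomHalving
    (H : ∀ L : ℕ, 1 < L → ∃ (N : ℕ) (B₃ a₅ : ℝ), 4 < B₃ ∧ 0 < a₅ ∧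
      ∀ F : T3Family, F.L = L → ∀ (n K : ℕ) (hnK : n < K), N ≤ F.L ^ (F.m + n) →
        ∀ (ε₀ ε₁ : ℝ), 0 < ε₁ → 0 < ε₀ → ε₀ ≤ a₅ →
          ∀ V : GaugeField (F.P n) 0 (Matrix.specialUnitaryGroup (Fin 2) ℂ), PlaqSmall ε₁ V →
            ∀ U ∈ regFibrePr F n K hnK.le ε₀ V,
              IsMinOn (fun W : GaugeField (F.P K) 0 (Matrix.specialUnitaryGroup (Fin 2) ℂ) => wilsonAction4 W) (regFibrePr F n K hnK.le ε₀ V) U →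
                RegPr F n K (max (B₃ * ε₁) (ε₀ / 2)) U) :
    ∀ (L : ℕ), 1 < L → ∃ B₃ : ℝ, 4 < B₃ ∧ ∃ a₅ : ℝ, 0 < a₅ ∧ ∃ N : ℕ,
      ∀ (i : Idx L), N ≤ (i.1.1).L ^ ((i.1.1).m + i.1.2.1) → ∀ (ε₀ ε₁ : ℝ), 0 < ε₁ → ∀ (V : (famX L i).Bdry) (U : (famX L i).Cfg),
        (famX L i).Reg7 ε₁ V → (famX L i).InU ε₀ U → (famX L i).InB V U → (famX L i).IsCritical V U → ε₀ ≤ a₅ →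
          (famX L i).InU (max (B₃ * ε₁) (ε₀ / 2)) U := by
  intro L hL
  obtain ⟨N, B₃, a₅, hB₃, ha₅, h⟩ := H L hL
  refine ⟨B₃, hB₃, a₅, ha₅, N, ?_⟩
  rintro ⟨⟨F, n, K⟩, hF, hnK⟩ hN ε₀ ε₁ hε₁ V U hV hU hB hcrit hε₀
  -- the carrier's predicates, read natively (definitional)
  have hF' : F.L = L := hF
  have hnK' : n < K := hnK
  have hN' : N ≤ F.L ^ (F.m + n) := hN
  have hV' : PlaqSmall ε₁ V := hV
  have hU' : RegPr F n K ε₀ U := hU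
  have hB' : U ∈ fibre F ℰp n K hnK'.le V := hB
  have hcrit' : IsCritR2 F n K hnK'.le V U := hcrit
  show RegPr F n K (max (B₃ * ε₁) (ε₀ / 2)) U
  obtain ⟨e, he, hUe, hmin⟩ := hcrit'
  have hε₀pos : 0 < ε₀ := Prop8Iter.eps_pos_of_regPr hU'
  have hr : 0 < min e ε₀ := lt_min he hε₀pos
  -- `U` lies in (6) at the radius `min{e, ε₀}` and minimises there
  have hUr : U ∈ regFibrePr F n K hnK'.le (min e ε₀) V := by
    rcases min_choice e ε₀ with hmn | hmn <;> rw [hmn]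
    · exact hUe
    · exact (mem_regFibrePr_iff F).mpr ⟨hB', hU'⟩
  have hminr : IsMinOn (fun W : GaugeField (F.P K) 0 (Matrix.specialUnitaryGroup (Fin 2) ℂ) => wilsonAction4 W)
      (regFibrePr F n K hnK'.le (min e ε₀) V) U :=
    hmin.on_subset (regFibrePr_mono F (min_le_left e ε₀) V)
  have hstep := h F hF' n K hnK' hN' (min e ε₀) ε₁ hε₁ hr ((min_le_right e ε₀).trans hε₀) V hV' U hUr hminr
  refine regPr_mono F (max_le_max le_rfl ?_) hstep
  exact div_le_div_of_nonneg_right (min_le_right e ε₀) (by norm_num)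

/-! ## §4 The door -/

/-- ★★★ **THE DOOR WITH THE ROOM BINDER** (★★OWNER RULING №29 (A), LEAD-H L-4 + addendum): from the P2 text `hP2` (✓p625735 `flatOpsAdmAtMS_allL` inhabits it), the P1♭ v1.1
text at the members with room `hP1room` (J-N05♭ `core′` ∕ J5 under the room premise `2ρ + Nr ≤ L^{F.m+n}`) and the C_E-end rows `hCE` (★w8-19200 lineage L4 `ceRows_of_chart`, floor
letter `Nce`), THE ROOM-STUB TEXT: the registered body of `BirthV10.stub_halvingStep` after `∀ L > 1` with ONE extra premise `N ≤ L^{F.m+n}` on the member, `N` ∃-bound after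
`a₅`.  The members below `N` (finitely many `(F.m+n)`-classes per `L`, every `K`) are NOT claimed here — «H-SMALL», the pure implication `stub_of_roomHalving : (∀ L,
RoomHalvingText L) → stub` (route (b7) cover lift in stationarity currency ∕ fallback (b3) flat background, ★★OWNER RULING №29 (B)).
[cite: Balaban1985Variational, (152)-(168) pp.301-304, Prop. 8 p.304; Balaban1985RegularSpaces, Thm 2 p.83] -/
theorem halvingStep_of_rows_room
    (hP2 : ∀ L : ℕ, Odd L → 1 < L → ∃ (R₀ M₀ : ℕ) (B₀ δ₀ B₃ : ℝ), 0 < B₀ ∧ 0 < δ₀ ∧ 0 < B₃ ∧ FlatOpsAdmAtMS L R₀ M₀ B₀ δ₀ B₃)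
    (hP1room : ∀ L : ℕ, Odd L → 1 < L → ∃ (Mₚ Rₚ : ℕ), ∀ (R M aₑ S : ℕ) (hM : 1 ≤ M), M = L ^ aₑ → Mₚ ≤ M → Rₚ ≤ R → R * M ≤ S →
      ∃ B₁ : ℝ, 0 ≤ B₁ ∧ ∃ Nr : ℕ,
      ∀ (ρ : ℕ) (a Cr : ℝ), 0 < Cr → 12 * ((ρ : ℝ) + (M : ℝ)) * a ≤ Cr →
        16 * 3800 * ((5 * L : ℕ) : ℝ) ^ 2 * (L : ℝ) * ((B₁ + 1) * a) ≤ 1 →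
        ∀ F : T3Family, F.L = L → ∀ (n K : ℕ) (hnK : n < K), 2 * ρ + Nr ≤ F.L ^ (F.m + n) →
          ∀ (ε₀ ε₁ : ℝ), 0 < ε₁ → 0 < ε₀ → ε₀ ≤ a → Cr * ε₁ ≤ ε₀ →
          ∀ V : GaugeField (F.P n) 0 (Matrix.specialUnitaryGroup (Fin 2) ℂ), PlaqSmall ε₁ V →
            ∀ U ∈ regFibrePr F n K hnK.le ε₀ V, ∀ x : Site (F.P K) 0,
              P1FlatPillarAt' F n K (cubeSeqMT3 F n K x ρ S M hM) (cubeSetM x (K - n) ρ S M 0) x ε₀ ε₁ B₁ 6 (8 * (L : ℝ) * (B₁ + 1)) U)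
    (hCE : ∀ L : ℕ, Odd L → 1 < L → ∀ (R₀ M₀ : ℕ) (B₀ δ₀ B₃ : ℝ), 0 < B₀ → 0 < δ₀ → 0 < B₃ → FlatOpsAdmAtMS L R₀ M₀ B₀ δ₀ B₃ →
      ∃ (M₁ R₁ : ℕ), ∀ (R M aₑ S : ℕ) (hM : 1 ≤ M), M = L ^ aₑ → M₁ ≤ M → M₀ ≤ M → R₁ ≤ R → R₀ ≤ R → R * M ≤ S →
      ∀ B₁ : ℝ, 0 ≤ B₁ →
      ∃ (Nce : ℕ) (K₁ K₂ C₂ Cce aCE : ℝ), 0 ≤ K₁ ∧ 0 ≤ K₂ ∧ 0 ≤ C₂ ∧ 0 ≤ Cce ∧ 0 < aCE ∧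
      ∀ ρ : ℕ, 1 ≤ ρ → ∀ F : T3Family, F.L = L → ∀ (n K : ℕ) (hnK : n < K), Nce ≤ F.L ^ (F.m + n) →
        ∀ (ε₀ ε₁ : ℝ), 0 < ε₁ → 0 < ε₀ → ε₀ ≤ aCE → Cce * ε₁ ≤ ε₀ →
        ∀ V : GaugeField (F.P n) 0 (Matrix.specialUnitaryGroup (Fin 2) ℂ), PlaqSmall ε₁ V →
          ∀ U ∈ regFibrePr F n K hnK.le ε₀ V,
            IsMinOn (fun W : GaugeField (F.P K) 0 (Matrix.specialUnitaryGroup (Fin 2) ℂ) => wilsonAction4 W) (regFibrePr F n K hnK.le ε₀ V) U →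
            ∀ (x : Site (F.P K) 0) (C₂' : ℝ) (u : GaugeTransf (F.P K) 0 (Matrix.unitaryGroup (Fin 2) ℂ)) (A : PBond (F.P K) 0 → Matrix (Fin 2) (Fin 2) ℂ),
              -- the seven conjuncts of `P1FlatPillarAt' F n K (cubeSeqMT3 …) (cubeSetM x (K−n) ρ S M 0) x ε₀ ε₁ B₁ 6 C₂' U` for THIS pair `(u, A)` ((ii′) on `□₀`)
              DP1Clause F n K (cubeSeqMT3 F n K x ρ S M hM) x U u →
              (∀ b : PBond (F.P K) 0, IsSelfAdjoint (A b)) → (∀ b : PBond (F.P K) 0, Matrix.trace (A b) = 0) →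
              (∀ (z : B7Prop1Explicit.Site (F.P K).d) (μ : Fin (F.P K).d),
                transl (0 : Site (F.P K) 0) z ∈ cubeSetM x (K - n) ρ S M 0 → (transl (0 : Site (F.P K) 0) z).shift μ ∈ cubeSetM x (K - n) ρ S M 0 →
                (Unitary.toUnits (u (transl 0 z)))⁻¹ * unitsField (toUField U) ⟨transl 0 z, μ⟩ * Unitary.toUnits (u ((transl 0 z).shift μ)) =
                  expUnit (I • ((((F.L : ℝ)⁻¹) ^ (K - n)) • A ⟨transl 0 z, μ⟩))) →
              (∀ w : ℕ → PBond (F.P K) 0 → ℝ, IsLevWeight F n K (cubeSeqMT3 F n K x ρ S M hM) w →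
                (∀ b : PBond (F.P K) 0, w 1 b * ‖A b‖ ≤ B₁ * ε₀) ∧
                (∀ (b : PBond (F.P K) 0) (ν : Fin (F.P K).d), w 2 b * (F.L : ℝ) ^ (K - n) * ‖A ⟨b.src.shift ν, b.dir⟩ - A b‖ ≤ B₁ * ε₀)) →
              (∃ μ : SiteIdx (cubeSeqMT3 F n K x ρ S M hM) → Matrix (Fin 2) (Fin 2) ℂ, ∀ s : Site (F.P K) 0,
                laplace ((F.L : ℝ) ^ (K - n)) (diverg ((F.L : ℝ) ^ (K - n)) A) s =
                  ∑ i : SiteIdx (cubeSeqMT3 F n K x ρ S M hM), siteAvgIter (i.1.1 : ℕ) (Pi.single s (1 : ℝ)) i.1.2 • μ i) →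
              (∀ c : BondIdx (cubeSeqMT3 F n K x ρ S M hM), (c.1.1 : ℕ) = K - n →
                c.1.2.src ∈ (cubeSeqMT3 F n K x ρ S M hM).Om (c.1.1 : ℕ) → c.1.2.tgt ∈ (cubeSeqMT3 F n K x ρ S M hM).Om (c.1.1 : ℕ) →
                ‖chartLogFlat (((F.L : ℝ)⁻¹) ^ (K - n)) (cubeSeqMT3 F n K x ρ S M hM) A c‖ ≤
                  6 * ε₁ * (distSite (Mk (F.P K) (c.1.1 : ℕ)) c.1.2.src (iterBlockOf (c.1.1 : ℕ) x) + 1)) →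
              (∀ c : BondIdx (cubeSeqMT3 F n K x ρ S M hM), ‖chartLogFlat (((F.L : ℝ)⁻¹) ^ (K - n)) (cubeSeqMT3 F n K x ρ S M hM) A c‖ ≤ C₂' * ε₀) →
              -- OUTPUT: `sitePackage_of_rows`'s rows for some `Hs`, `C`, `e₁`, `e₃`
              ∃ (Hs : (BondIdx (cubeSeqMT3 F n K x ρ S M hM) → Matrix (Fin 2) (Fin 2) ℂ) → (PBond (F.P K) 0 → Matrix (Fin 2) (Fin 2) ℂ))
                (C : (PBond (F.P K) 0 → Matrix (Fin 2) (Fin 2) ℂ) → (BondIdx (cubeSeqMT3 F n K x ρ S M hM) → Matrix (Fin 2) (Fin 2) ℂ))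
                (e₁ e₃ : ℝ),
                ((∀ (z : B7Prop1Explicit.Site (F.P K).d) (τ : Fin (F.P K).d),
                    SideTouches (pullDom (fun j => if K - n ≤ j then ({x} : Set (Site (F.P K) 0)) else (∅ : Set (Site (F.P K) 0))) (K - n)) z τ →
                    ‖((A + Hs (C A)) - fun b : PBond (F.P K) 0 => ∑ c, flatH F n K (cubeSeqMT3 F n K x ρ S M hM) (Pi.single c 1) b •
                        bondAvgIter (c.1.1 : ℕ) (A + Hs (C A)) c.1.2) ⟨transl 0 z, τ⟩‖ ≤ e₁) ∧
                  (∀ (z : B7Prop1Explicit.Site (F.P K).d) (κ τ : Fin (F.P K).d),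
                    SideTouches (pullDom (fun j => if K - n ≤ j then ({x} : Set (Site (F.P K) 0)) else (∅ : Set (Site (F.P K) 0))) (K - n)) z τ →
                    ‖(((F.L : ℝ)⁻¹) ^ (K - n))⁻¹ •
                      (((A + Hs (C A)) - fun b : PBond (F.P K) 0 => ∑ c, flatH F n K (cubeSeqMT3 F n K x ρ S M hM) (Pi.single c 1) b •
                          bondAvgIter (c.1.1 : ℕ) (A + Hs (C A)) c.1.2) ⟨(transl 0 z).shift κ, τ⟩ -
                        ((A + Hs (C A)) - fun b : PBond (F.P K) 0 => ∑ c, flatH F n K (cubeSeqMT3 F n K x ρ S M hM) (Pi.single c 1) b •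
                          bondAvgIter (c.1.1 : ℕ) (A + Hs (C A)) c.1.2) ⟨transl 0 z, τ⟩)‖ ≤ e₁) ∧
                  (∀ (z : B7Prop1Explicit.Site (F.P K).d) (μ : Fin (F.P K).d),
                    BondTouches (pullDom (fun j => if K - n ≤ j then ({x} : Set (Site (F.P K) 0)) else (∅ : Set (Site (F.P K) 0))) (K - n)) z μ →
                    ‖pdiv (((F.L : ℝ)⁻¹) ^ (K - n)) (1 : B7Prop1Explicit.Site (F.P K).d → Fin (F.P K).d → (Matrix (Fin 2) (Fin 2) ℂ)ˣ)
                        (plaqCovDeriv (((F.L : ℝ)⁻¹) ^ (K - n)) (1 : B7Prop1Explicit.Site (F.P K).d → Fin (F.P K).d → (Matrix (Fin 2) (Fin 2) ℂ)ˣ)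
                          (pull ((A + Hs (C A)) - fun b : PBond (F.P K) 0 => ∑ c, flatH F n K (cubeSeqMT3 F n K x ρ S M hM) (Pi.single c 1) b •
                            bondAvgIter (c.1.1 : ℕ) (A + Hs (C A)) c.1.2) 0)) μ z‖ ≤ e₁)) ∧
                ((∀ (z : B7Prop1Explicit.Site (F.P K).d) (τ : Fin (F.P K).d),
                    SideTouches (pullDom (fun j => if K - n ≤ j then ({x} : Set (Site (F.P K) 0)) else (∅ : Set (Site (F.P K) 0))) (K - n)) z τ →
                    ‖Hs (C A) ⟨transl 0 z, τ⟩‖ ≤ e₃) ∧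
                  (∀ (z : B7Prop1Explicit.Site (F.P K).d) (κ τ : Fin (F.P K).d),
                    SideTouches (pullDom (fun j => if K - n ≤ j then ({x} : Set (Site (F.P K) 0)) else (∅ : Set (Site (F.P K) 0))) (K - n)) z τ →
                    ‖(((F.L : ℝ)⁻¹) ^ (K - n))⁻¹ • (Hs (C A) ⟨(transl 0 z).shift κ, τ⟩ - Hs (C A) ⟨transl 0 z, τ⟩)‖ ≤ e₃) ∧
                  (∀ (z : B7Prop1Explicit.Site (F.P K).d) (μ : Fin (F.P K).d),
                    BondTouches (pullDom (fun j => if K - n ≤ j then ({x} : Set (Site (F.P K) 0)) else (∅ : Set (Site (F.P K) 0))) (K - n)) z μ →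
                    ‖pdiv (((F.L : ℝ)⁻¹) ^ (K - n)) (1 : B7Prop1Explicit.Site (F.P K).d → Fin (F.P K).d → (Matrix (Fin 2) (Fin 2) ℂ)ˣ)
                        (plaqCovDeriv (((F.L : ℝ)⁻¹) ^ (K - n)) (1 : B7Prop1Explicit.Site (F.P K).d → Fin (F.P K).d → (Matrix (Fin 2) (Fin 2) ℂ)ˣ)
                          (pull (Hs (C A)) 0)) μ z‖ ≤ e₃)) ∧
                (∀ c : BondIdx (cubeSeqMT3 F n K x ρ S M hM), (c.1.1 : ℕ) = K - n →
                  c.1.2.src ∈ (cubeSeqMT3 F n K x ρ S M hM).Om (c.1.1 : ℕ) → c.1.2.tgt ∈ (cubeSeqMT3 F n K x ρ S M hM).Om (c.1.1 : ℕ) →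
                  ‖bondAvgIter (c.1.1 : ℕ) (A + Hs (C A)) c.1.2‖ ≤ 6 * ε₁ * (distSite (Mk (F.P K) (c.1.1 : ℕ)) c.1.2.src (iterBlockOf (c.1.1 : ℕ) x) + 1)) ∧
                (∀ c : BondIdx (cubeSeqMT3 F n K x ρ S M hM),
                  ¬ ((c.1.1 : ℕ) = K - n ∧ c.1.2.src ∈ (cubeSeqMT3 F n K x ρ S M hM).Om (c.1.1 : ℕ) ∧
                      c.1.2.tgt ∈ (cubeSeqMT3 F n K x ρ S M hM).Om (c.1.1 : ℕ)) →
                  ‖bondAvgIter (c.1.1 : ℕ) (A + Hs (C A)) c.1.2‖ ≤ C₂ * ε₀ * (F.L : ℝ) ^ ((K - n) - (c.1.1 : ℕ))) ∧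
                e₁ ≤ K₁ * ε₀ ^ 2 ∧ e₃ ≤ K₂ * ε₀ ^ 2) :
    ∀ (L : ℕ), 1 < L → ∃ B₃ : ℝ, 4 < B₃ ∧ ∃ a₅ : ℝ, 0 < a₅ ∧ ∃ N : ℕ,
      ∀ (i : Idx L), N ≤ (i.1.1).L ^ ((i.1.1).m + i.1.2.1) → ∀ (ε₀ ε₁ : ℝ), 0 < ε₁ → ∀ (V : (famX L i).Bdry) (U : (famX L i).Cfg),
        (famX L i).Reg7 ε₁ V → (famX L i).InU ε₀ U → (famX L i).InB V U → (famX L i).IsCritical V U → ε₀ ≤ a₅ →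
          (famX L i).InU (max (B₃ * ε₁) (ε₀ / 2)) U :=
  roomStubText_of_roomHalving (roomHalving_of_rows hP2 hP1room hCE)

end Door

end Summit.QuantumFields.YangMills.Theorems.HalvingStepOfPillarsRoomDoor

end
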